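import Literature.AlgebraicGeometry.Resolution.AffineDomainDimension
import Literature.AlgebraicGeometry.Resolution.RegularLocalRings
import HarnessLib

/-!
# `PAlteration.PicoverToRadicialBottom` (stmt-ResolutionOfSingularities-0556): regularity of an exhausted local ring

Route `ResolutionOfSingularities/pAlteration`, crux `PicoverToRadicialBottom` (stmt-0556), line
`theta-finite-cofinite-roots`; helper file (`--supports`), stub `stub_directedUnionRegular`.

Let `O` be a Noetherian local ring and `φ_i : O_i → O` (`i ∈ ι`) injective, local, integral ring
homomorphisms from regular local rings `O_i` such that every finite subset of `O` lies in the
image of some `φ_i` (in the line: `O` is a local ring of the base change of a regular variety to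
the infinite purely inseparable extension `L = ⋃ L_S`, exhausted by the local rings `O_S` of the
finite, regular stages). Then `O` is regular.

Proof. Choose finitely many generators `x_1, …, x_n` of `𝔪_O` (Noetherian) and an index `i`
with all `x_l ∈ φ_i(O_i)`, say `x_l = φ_i(y_l)`. Since `φ_i` is local, `φ_i⁻¹(𝔪_O) = 𝔪_{O_i}`,
so `y_l ∈ 𝔪_{O_i}` and `𝔪_O ⊆ 𝔪_{O_i} O ⊆ 𝔪_O`, i.e. `𝔪_O = 𝔪_{O_i} O`
(`maximalIdeal_eq_map_of_span_subset_range`). Hence `𝔪_O` is generated by the images of the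
`dim O_i` minimal generators of `𝔪_{O_i}` (regularity of `O_i`), and `dim O_i = dim O` because
`φ_i` is injective and integral (going up and incomparability,
`Literature.AlgebraicGeometry.Resolution.ringKrullDim_eq_of_isIntegral`). So `𝔪_O` is generated
by `dim O` elements and `O` is regular (`IsRegularLocalRing.of_spanFinrank_maximalIdeal_le`).
(This is the generator-count form of the cotangent-space argument: any `dim O + 1` elements of
`𝔪_O` come from some `𝔪_{O_i}` and are dependent modulo `𝔪_{O_i}²`, hence modulo `𝔪_O²`.)
-/

-- single-problem summit: the doubled namespace component `ResolutionOfSingularities` is forced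
set_option linter.dupNamespace false

noncomputable section

open IsLocalRing

namespace Summit.ResolutionOfSingularities.ResolutionOfSingularities.Theorems

/-- If a local homomorphism `φ : P → O` of local rings has a generating set of `𝔪_O` in its
image, then `𝔪_O` is the extension of `𝔪_P` along `φ`: `𝔪_O = 𝔪_P O`. [folklore] -/
theorem maximalIdeal_eq_map_of_span_subset_range {P O : Type*} [CommRing P] [CommRing O]
    [IsLocalRing P] [IsLocalRing O] (φ : P →+* O) [IsLocalHom φ] {s : Set O}
    (hs : Ideal.span s = maximalIdeal O) (hsub : s ⊆ Set.range φ) :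
    maximalIdeal O = (maximalIdeal P).map φ := by
  refine le_antisymm ?_ (map_maximalIdeal_le φ)
  rw [← hs, Ideal.span_le]
  intro x hx
  obtain ⟨y, rfl⟩ := hsub hx
  refine Ideal.mem_map_of_mem φ ?_
  rw [← maximalIdeal_comap φ, Ideal.mem_comap, ← hs]
  exact Ideal.subset_span hx

/-- If a local homomorphism `φ : P → O` of local rings, `P` Noetherian, has a generating set of
`𝔪_O` in its image, then `𝔪_O` needs at most as many generators as `𝔪_P`. [folklore] -/
theorem spanFinrank_maximalIdeal_le_of_span_subset_range {P O : Type*} [CommRing P]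
    [CommRing O] [IsLocalRing P] [IsLocalRing O] [IsNoetherianRing P] (φ : P →+* O)
    [IsLocalHom φ] {s : Set O} (hs : Ideal.span s = maximalIdeal O) (hsub : s ⊆ Set.range φ) :
    (maximalIdeal O).spanFinrank ≤ (maximalIdeal P).spanFinrank := by
  rw [maximalIdeal_eq_map_of_span_subset_range φ hs hsub]
  exact Ideal.spanFinrank_map_le_of_fg φ (maximalIdeal P).fg_of_isNoetherianRing

/-- **Regularity passes to a local ring exhausted by regular local rings along injective local
integral maps.** Let `O` be a Noetherian local ring and `φ_i : O_i → O` injective, local,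
integral ring homomorphisms from regular local rings `O_i` such that every finite subset of `O`
lies in the image of some `φ_i`. Then `O` is a regular local ring: `𝔪_O = 𝔪_{O_i} O` for an
index `i` whose image contains generators of `𝔪_O`, so `𝔪_O` is generated by
`dim O_i = dim O` elements. [folklore] -/
theorem stub_directedUnionRegular :
    ∀ (O : Type) [CommRing O] [IsLocalRing O] [IsNoetherianRing O] (ι : Type) (Oi : ι → Type)
      [∀ i, CommRing (Oi i)] [∀ i, IsLocalRing (Oi i)] (φ : ∀ i, Oi i →+* O),
      (∀ i, IsLocalHom (φ i)) → (∀ i, Function.Injective (φ i)) → (∀ i, (φ i).IsIntegral) →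
      (∀ i, IsRegularLocalRing (Oi i)) →
      (∀ s : Finset O, ∃ i, (s : Set O) ⊆ Set.range (φ i)) →
      IsRegularLocalRing O := by
  intro O _ _ _ ι Oi _ _ φ hloc hinj hint hreg hcov
  -- generators of `𝔪_O` and an index whose image contains them
  obtain ⟨s, hs⟩ := (maximalIdeal O).fg_of_isNoetherianRing
  obtain ⟨i, hi⟩ := hcov s
  haveI := hloc i
  haveI := hreg i
  -- `𝔪_O = 𝔪_{O_i} O` needs at most `spanFinrank 𝔪_{O_i} = dim O_i` generators
  have hle : (maximalIdeal O).spanFinrank ≤ (maximalIdeal (Oi i)).spanFinrank :=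
    spanFinrank_maximalIdeal_le_of_span_subset_range (φ i) hs hi
  -- `dim O = dim O_i` along the injective integral map `φ_i`
  letI : Algebra (Oi i) O := (φ i).toAlgebra
  haveI : Algebra.IsIntegral (Oi i) O := algebraMap_isIntegral_iff.mp (hint i)
  have hdim : ringKrullDim O = ringKrullDim (Oi i) :=
    Literature.AlgebraicGeometry.Resolution.ringKrullDim_eq_of_isIntegral (hinj i)
  refine IsRegularLocalRing.of_spanFinrank_maximalIdeal_le O ?_
  calc ((maximalIdeal O).spanFinrank : WithBot ℕ∞) ≤ (maximalIdeal (Oi i)).spanFinrank := by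
        exact_mod_cast hle
    _ = ringKrullDim (Oi i) := IsRegularLocalRing.spanFinrank_maximalIdeal
    _ = ringKrullDim O := hdim.symm

end Summit.ResolutionOfSingularities.ResolutionOfSingularities.Theorems

end
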